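import Summits.BirchSwinnertonDyer.Rank1Residual.F1Sign2.TwistSelmerRelaxedAtInfinityAtTwo
import Literature.NumberTheory.EllipticCurves.SelmerTorsionRestriction
import HarnessLib

/-!
# Cell `bsd-f1-sign2` — DEFINITION REQUEST D-53-∞ (-imc g17, MEMO-imc §10.96-add5, ask A-53-12 to -ty): the ARCHIMEDEAN SELMER LINE at `p = 2`

DEFINITIONS ONLY (three carriers with bodies + four proved API lemmas; no `Prop` row, nothing asserted, no `sorry`, no instance), typer
-ty g16.  -imc's request (verbatim): «definition request D-53-∞ (`archSelmerLine`, needs the restriction map `Sel₂ → H¹(ℝ, E[2])` over the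
tree's `selmerGroup`); the three Props [P53↻/P53½/P53∞ of Sketch53 v9] are its typed shadows over existing declarations» and «the sign is
the position of the archimedean Selmer line `T_I ∈ {T♮, T♭}`, transported rigidly along mod-2 congruences … `T_I = T♮` iff some `2`-Selmer
class of `E` is alive at `∞`».

THE TREE ALREADY HAS BOTH INGREDIENTS, so the request is served by composition, not by new theory:
* the restriction map with TORSION coefficients `res_∞ : H¹(ℚ, W[2]) → H¹(ℝ, W_ℝ[2])` is the tree's
  `Literature.NumberTheory.EllipticCurves.resTorsion W ℝ 2` (`Literature/NumberTheory/EllipticCurves/SelmerTorsionRestriction.lean`: restriction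
  along the compatible pair `(resGal ℝ, torsionBaseChangeMap)`, [cite: SerreGaloisCohomology1997, I.§2.4 (compatible pairs)]);
* the `∞`-RELAXED `2`-Selmer group `Sel^{rel ∞}_2(W)` is -desc's `selmerGroupRelaxedAtInfinityAtTwo W` (`F1Sign2/TwistSelmerRelaxedAtInfinityAtTwo.lean`,
  [cite: MazurRubin2010, Def 3.1]), with `Sel₂(W) ≤ Sel^{rel ∞}_2(W)` proved there.
Hence: `resInfinityAtTwo W := resTorsion W ℝ 2`; **`archSelmerLineAtTwo W := res_∞ (Sel^{rel ∞}_2(W)) ⊆ H¹(ℝ, W_ℝ[2])`** (-imc's `I`, the line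
`T_I`: by Poitou–Tate / [cite: PoonenRains2012, Prop. 4.10, Thm. 4.13] the image of the `{∞}`-relaxed group is maximal isotropic for the local
quadratic form, i.e. a LINE of the plane `H¹(ℝ, W[2]) ≅ W[2]` when `Δ_W > 0` and `0` when `Δ_W < 0` — NOT proved here; REF1 §180 R180a
«never middle»: `I ∈ {⟨T♮⟩, ⟨T♭⟩}`); `selmerImageAtInfinityAtTwo W := res_∞ (Sel₂(W)) ≤ archSelmerLineAtTwo W` (proved, `map_mono`); and the bit
**`SelmerAliveAtInfinityAtTwo W` := «some `2`-Selmer class of `W` has nonzero restriction to `H¹(ℝ, W_ℝ[2])`»** (⟺ `selmerImageAtInfinityAtTwo W ≠ ⊥`,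
proved) — -imc's «`T_I = T♮`».  DICTIONARY with the tree's index formulation (NOT proved here; [cite: MazurRubin2010, Lemma 3.2] + never-middle):
`SelmerAliveAtInfinityAtTwo W` ⟺ `Sel₂(W) = Sel^{rel ∞}_2(W)` (index 1 in `SelmerIndexInRelaxedAtInfinityAtTwo`) ⟺ `I = L_∞ := δ(W(ℝ)/2W(ℝ)) = ⟨T♮⟩`
(`T♮ = (e₁, 0)`, the least root; -desc's «UP/DOWN» bit `β(W)` of `F1Sign2/DescentSignAtTwo.lean` is its cardinality shadow).  No census is attached
to a definition; the laws that use it (Sketch53 v9: P53↻ `TwoSelmerCycleOrientationLawAtTwo`, P53½, P53∞, and the transport «`β T_I(E) = T_I(E')`»)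
are REF-gated (D-imc-53-R5) and not filed here.  BSD is not proved by any of this; no item closed.
-/

noncomputable section

open scoped Classical

open WeierstrassCurve Literature.NumberTheory.EllipticCurves

namespace Summit.BirchSwinnertonDyer.Rank1Residual.F1Sign2

/-- The restriction map at the real place with `2`-torsion coefficients, `res_∞ : H¹(ℚ, W[2]) → H¹(ℝ, W_ℝ[2])` — the tree's
`resTorsion W ℝ 2` (restriction along `(resGal ℝ, torsionBaseChangeMap)`). [cite: SerreGaloisCohomology1997, I.§2.4 (compatible pairs)] -/
abbrev resInfinityAtTwo (W : WeierstrassCurve ℚ) :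
    W.galH1Torsion ((2 : ℕ) : ℤ) →+ (W.baseChange ℝ).galH1Torsion ((2 : ℕ) : ℤ) :=
  resTorsion W ℝ ((2 : ℕ) : ℤ)

/-- **The ARCHIMEDEAN SELMER LINE** `I(W) := res_∞ (Sel^{rel ∞}_2(W)) ⊆ H¹(ℝ, W_ℝ[2])` (D-53-∞): the image at the real place of the
`∞`-relaxed `2`-Selmer group (finite local conditions only).  Maximal isotropic for the local Tate quadratic form by Poitou–Tate
(a line when `Δ_W > 0`, zero when `Δ_W < 0`) — that is a theorem of the literature, not part of this definition.
[cite: MazurRubin2010, Def 3.1, Lemma 3.2] [cite: PoonenRains2012, Prop. 4.10, Thm. 4.13] -/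
def archSelmerLineAtTwo (W : WeierstrassCurve ℚ) : AddSubgroup ((W.baseChange ℝ).galH1Torsion ((2 : ℕ) : ℤ)) :=
  (selmerGroupRelaxedAtInfinityAtTwo W).map (resInfinityAtTwo W)

/-- The image at the real place of the `2`-Selmer group itself, `res_∞ (Sel₂(W)) ⊆ H¹(ℝ, W_ℝ[2])` (inside `W(ℝ)/2W(ℝ)` by the Kummer
sequence; contained in the archimedean Selmer line). [cite: MazurRubin2010, Def 3.1] [cite: Kramer1981, Prop. 6 (the archimedean index `i_∞`)] -/
def selmerImageAtInfinityAtTwo (W : WeierstrassCurve ℚ) : AddSubgroup ((W.baseChange ℝ).galH1Torsion ((2 : ℕ) : ℤ)) :=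
  (W.selmerGroup ((2 : ℕ) : ℤ)).map (resInfinityAtTwo W)

/-- **«Some `2`-Selmer class of `W` is ALIVE at `∞`»** (-imc's bit `T_I = T♮`): a class of `Sel₂(W)` with nonzero restriction to
`H¹(ℝ, W_ℝ[2])`.  (Dictionary, not proved here: ⟺ `Sel₂(W) = Sel^{rel ∞}_2(W)` ⟺ `I(W) = ⟨T♮⟩`, [cite: MazurRubin2010, Lemma 3.2] with REF1 §180
R180a «never middle».) -/
def SelmerAliveAtInfinityAtTwo (W : WeierstrassCurve ℚ) : Prop :=
  ∃ c ∈ W.selmerGroup ((2 : ℕ) : ℤ), resInfinityAtTwo W c ≠ 0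

/-- API (proved): `res_∞ (Sel₂(W)) ≤ I(W)`, because `Sel₂(W) ≤ Sel^{rel ∞}_2(W)`. [cite: MazurRubin2010, Def 3.1] -/
theorem selmerImageAtInfinityAtTwo_le_archSelmerLineAtTwo (W : WeierstrassCurve ℚ) :
    selmerImageAtInfinityAtTwo W ≤ archSelmerLineAtTwo W :=
  AddSubgroup.map_mono (selmerGroup_le_selmerGroupRelaxedAtInfinityAtTwo W)

/-- API (proved): unfolding of `archSelmerLineAtTwo`. [cite: MazurRubin2010, Def 3.1] -/
theorem mem_archSelmerLineAtTwo_iff (W : WeierstrassCurve ℚ) (x : (W.baseChange ℝ).galH1Torsion ((2 : ℕ) : ℤ)) :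
    x ∈ archSelmerLineAtTwo W ↔ ∃ c ∈ selmerGroupRelaxedAtInfinityAtTwo W, resInfinityAtTwo W c = x :=
  AddSubgroup.mem_map

/-- API (proved): «alive at `∞`» iff the Selmer image at `∞` is nonzero. [cite: MazurRubin2010, Lemma 3.2] -/
theorem selmerAliveAtInfinityAtTwo_iff (W : WeierstrassCurve ℚ) :
    SelmerAliveAtInfinityAtTwo W ↔ selmerImageAtInfinityAtTwo W ≠ ⊥ := by
  rw [Ne, AddSubgroup.eq_bot_iff_forall]
  constructor
  · rintro ⟨c, hc, hne⟩ h
    exact hne (h _ (AddSubgroup.mem_map_of_mem _ hc))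
  · intro h
    by_contra hcon
    apply h
    intro x hx
    obtain ⟨c, hc, rfl⟩ := AddSubgroup.mem_map.mp hx
    by_contra hx0
    exact hcon ⟨c, hc, hx0⟩

/-- API (proved): NOT alive at `∞` iff `Sel₂(W)` restricts to zero at the real place (the «strict at `∞`» / DOWN branch).
[cite: MazurRubin2010, Lemma 3.2] -/
theorem not_selmerAliveAtInfinityAtTwo_iff (W : WeierstrassCurve ℚ) :
    ¬ SelmerAliveAtInfinityAtTwo W ↔ W.selmerGroup ((2 : ℕ) : ℤ) ≤ (resInfinityAtTwo W).ker := by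
  simp only [SelmerAliveAtInfinityAtTwo, not_exists, not_and, not_not]
  exact ⟨fun h c hc => (AddMonoidHom.mem_ker).mpr (h c hc), fun h c hc => (AddMonoidHom.mem_ker).mp (h hc)⟩

end Summit.BirchSwinnertonDyer.Rank1Residual.F1Sign2

end
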